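import Mathlib
import Summits.Langlands.Langlands.Theses.PhantomRMYoshida
import Literature.NumberTheory.GaloisRepresentations.IntegralGaloisActionProofs
import Summits.Langlands.Langlands.Theorems.PhantomRMYoshidaStableYoshidaCongruenceSteinbergMonodromy
import Summits.Langlands.Langlands.Theorems.PhantomRMYoshidaStableYoshidaCongruenceSteinbergEigenvalueRatio
import Summits.Langlands.Langlands.Theorems.PhantomRMYoshidaStableYoshidaCongruenceSteinbergCongruence
import Summits.Langlands.Langlands.Theorems.PhantomRMYoshidaStableYoshidaCongruenceInvariantSubspaceFinrankTwo
import Summits.Langlands.Langlands.Theorems.PhantomRMYoshidaStableYoshidaCongruenceCrossPlaceOfCrossElement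

/-!
# Line `serre-dual-ribet-square` — skeleton for crux `PhantomRMYoshida.StableYoshidaCongruence`
# (stmt-Langlands-13640, route-Langlands-PhantomRMYoshida; crux-plan, round 1)

**Idea** (crux-idea card `serre-dual-ribet-square`, ideator 3; triage r1: pass ×3 "with doubt").  The
route's own engine S1 + S2 made concrete in CLASSICAL COHERENT `H⁰` of weight `(2,2)`: start from the
holomorphic `p`-ordinary Yoshida lift `Y(f,g)` of the pair (`f, g` the `p`-ordinary weight-2 newforms
lifting `σ̄, σ̄'`, simultaneously level-raised at one auxiliary prime `w₀` so that a holomorphic member of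
the Yoshida packet exists — hypothesis (yos), Disproof §5 R5), let `𝔪` be its (ordinary, residually
`σ̄ ⊕ σ̄'`) maximal ideal of the Hecke algebra, pick a CROSS-RATIO place `v = r` of the pair
(`σ̄'(Frob_r)` has an eigenvalue `r · (eigenvalue of σ̄(Frob_r))` and neither `σ̄(Frob_r)` nor
`σ̄'(Frob_r)` has an internal eigenvalue ratio `r^{±1}`), and run Ribet's INTEGRAL CONGRUENCE-MODULE
argument on the torsion-free lattices `M = H⁰(X_{K^r K_r}, ω²(-D); 𝒪)_𝔪` (hyperspecial at `r`) and
`L = H⁰(X_{K^r I_r}, ω²(-D); 𝒪)_𝔪` (Iwahori at `r`): the old map `i : M^{⊕8} → L` (all `|W| = 8`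
Iwahori–Hecke degeneracies), the trace map `t : L → M^{⊕8}`, `t ∘ i = H ∈ M₈(𝕋)` with
`det H = unit · Δ_r`, `Δ_r =` the full level-raising element `∏_{root ratios}(1 - ratio · r⁻¹)`, which
lies in `𝔪` through its CROSS factors.  GIVEN the two integral inputs (C⁺, the line's bet):
(Ihara/genericity) `i ⊗ κ` injective at `𝔪`, and (dual Ihara, "Serre-dual" side) `t` surjective at `𝔪`,
Ribet's square yields an `r`-NEW ordinary holomorphic weight-`(2,2)` eigenform `π' ≡ 𝔪`; `π'_r` is a
ramified Iwahori-spherical representation, so `π'` is NOT of Yoshida type (an Iwahori-spherical ramified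
member of a local Yoshida packet forces a Steinberg constituent, i.e. an INTERNAL ratio `r` — excluded by
the choice of `r`; this is the typed `stub_steinbergCongruence`), hence of general type: its Galois
representation `ρ₀` is symplectic-`ε⁻¹`, Greenberg-ordinary `(0,0,1,1)` and `p`-distinguished (ordinarity
of `𝔪`), residually `σ̄ ⊕ σ̄'`, cuspidal on `GL₄` (Arthur / Gee–Taïbi), and irreducible by
Fontaine–Mazur + Jacquet–Shalika (`stub_irreducibleOfCuspidalGL4`).

**Planner's correction of the card's local set-up** (recorded for the lead; details in the line card
`Lines/serre-dual-ribet-square.md` §Triage answers).  The card's square used the TWO degeneracy maps from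
hyperspecial level to the Siegel parahoric `K_r ∩ K_r^δ`, `δ = diag(1,1,r,r)`, and its first lemma
`⟨Sp₄(ℤ_r), Sp₄(ℤ_r)^δ⟩ = Sp₄(ℚ_r)` (true).  That square is RANK-DEFICIENT for `GSp₄`
(`dim I(χ)^{Si(r)} = |W/W_{Si}| = 4 > 2`): its "new" part contains `r`-unramified eigenvectors, so
`Ω_𝔪 ≠ 0` proves nothing — exactly the phenomenon in Sorensen 2006 (arXiv:math/0504332): the two-vertex
square (Thm 2) needs `π_w ≡ 𝟙 mod λ` (Satake parameter congruent to the TRIVIAL representation's) and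
yields only `π̃_w^J ≠ π̃_w^K + π̃_w^{K'}`; for `U(3)` (Thm 3) "we cannot prove by our methods that `π̃_q` is
ramified", and for `GSp(4)` with the Klingen parahoric (Thm 4) ramification is likewise left open.  At a
cross-ratio prime the residual Satake parameter `{a, ra, b, b/r}` sits on the type-III reducibility locus
(isotropic ratio-`r` pairs), the expected new local component is `IIIa = χ ⋊ σSt_{GSp(2)}` (generic,
conductor `r²`, Iwahori-spherical, NOT a discrete series — so no definite-inner-form / supersingular-locus
shortcut, and weight `(2,2)` forbids compact inner forms at `∞` anyway), and the square must use the FULL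
Iwahori–Hecke old space (`8` degeneracies).  Its Ihara input is then the Clozel–Harris–Taylor-type
GENERICITY statement "the `𝔪`-part of mod-`p` weight-`(2,2)` coherent `H⁰`, as a smooth
`𝔽̄_p[GSp₄(ℚ_r)]`-module, has no non-generic (here: `IIIb`-type) irreducible SUBmodule" — not the amalgam
lemma, which only kills one-dimensional (abelian / Eisenstein) submodules.  This is open and is the
load-bearing content of `stub_crossRatioRibetPackage`.

**Shape.** `StableYoshidaCongruence_of : StableYoshidaCongruence` (no hypotheses) is proved at the end of
this file from four `stub_*` theorems; `sorry` occurs only inside the stubs; stub statements mention only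
Mathlib, `Literature.*` and (verbatim, as `let`s) the clauses of the route decl, so each can land as
`Theorems/StableYoshidaCongruence<Stub>.lean` with `--supports stmt-Langlands-13640`.

* `stub_crossRatioRibetPackage` — THE LEVER (hardest; automorphic; contains C⁺).  At a cross-ratio place
  `v ∤ p` of an eligible ordinary Yoshida pair: EITHER (A, general type) an `Sh`-shaped `ρ₀`, cuspidal on
  `GL₄`, unramified outside `{p, v, w₀} ∪ ram(σ̄) ∪ ram(σ̄')` for ONE auxiliary place `w₀` (the (yos)
  prime) — a level prediction strictly stronger than the crux's "some level" — OR (B, Yoshida type) a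
  two-dimensional `ρ₁`, unipotently RAMIFIED at `v`, whose Frobenius polynomial at `v` is integral and
  reduces to `charpoly σ̄(Frob_v)` or `charpoly σ̄'(Frob_v)` (the Steinberg constituent of an endoscopic
  `v`-new form, by Carayol).  Open (XL⁺).
* `stub_steinbergCongruence` — Galois-side level-raising congruence (Ribet's necessary condition, no
  automorphic input): a continuous `ρ₁ : Γ_ℚ → GL₂(ℚ̄_p)` whose inertia at `v ∤ p` acts unipotently and
  non-trivially has Frobenius roots `{x, q_v x}`; if its Frobenius polynomial reduces to `(X-a)(X-b)` then
  `a = q_v b` or `b = q_v a`.  Kills branch (B) at a cross-ONLY place.  Provable now (M on paper; tame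
  inertia structure in Lean: L).
* `stub_irreducibleOfCuspidalGL4` — an `Sh`-shaped `ρ₀` (Greenberg-ordinary `(0,0,1,1)`, residually
  `σ̄ ⊕ σ̄'` with `σ̄, σ̄'` irreducible, `det σ̄ = ε̄⁻¹`) which is cuspidal-automorphic on `GL₄` is
  irreducible: a `2+2` decomposition is de Rham of Hodge–Tate types `{0,1}|{0,1}` (Kisin's Fontaine–Mazur)
  or `{0,0}|{1,1}` (Sen + Pilloni–Stroh weight-one Fontaine–Mazur), both contradicting cuspidality by
  Jacquet–Shalika.  In print for `p ≥ 5`; `p = 3` small-image residue flagged.  (L.)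
* `stub_noCrossPlaceSector` — SECTOR stub: pairs with NO cross-only place (by Chebotarev a tiny-image
  condition on `im(σ̄ × σ̄')`; Disproof §5 R7: engine S1 fails exactly for projective images of order
  `≤ 10` in the phantom family) get an `Sh`-shaped `GL₄`-cuspidal lift from the explicit functorial
  constructions of Disproof §5 R1/D1 (twist pairs, aligned dihedral pairs: `ρ₀ = ρ_g^∨ ⊗ Ind θ`) and R2
  (`p = 3`, Burkhardt–Weddle switch); honest open residue = tiny-image pairs outside R1/D1/R2.  Stated as
  the crux's conclusion minus irreducibility on that locus (open).

**Glue** (sorry-free, below): `by_cases` on the existence of a cross-only place `(v; a,b | c,d)`;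
YES ⟶ package ⟶ branch (A): irreducibility stub ⟶ done; branch (B): `stub_steinbergCongruence` gives an
internal ratio `a = q b ∨ b = q a` (or for `c, d`), contradicting cross-only; NO ⟶ sector stub ⟶
irreducibility stub ⟶ done.  `AutGL2 σ / AutGL2 σ'`, `∃ ρ, Sh ρ`, `DetCond`, `NonConj` are consumed only
by the package / sector stubs (they certify the ordinary holomorphic Yoshida START and the shape of `𝔪`).

**Disproof used** (`Cruxes/StableYoshidaCongruence/Disproof.lean`, cdisprove cycle 3, in tree, read in
full): §2 `exists_cuspForm_of_not_crux` — the automorphic wall: NO `_false_without_H` theorem exists for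
any hypothesis `H`, so there is no `_false_without_` obstruction to honour by name; §4 `loadBearing`: H5
(`∃ ρ, Sh ρ`) is the load-bearing hypothesis and certifies only the REDUCIBLE witness — honoured: the
package uses H5 exactly as "`𝔪` is ordinary and `p`-distinguished, `f, g` exist" (line card, Stub 1,
L1.1) and never as an irreducible point; H1/H1' (`AutGL2`) decoration modulo KW — passed through, unused
otherwise; §3.2 `sector_iff_irr'` (the Irr'-trap) — avoided: no stub takes an irreducible witness, the
line attacks the reducible-witness surplus; §3.3 `crux_iff_lifting` — the package's branch (A) is an
automorphic CONSTRUCTION of the irreducible lift at a predicted level, not a lifting theorem; §5 R5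
(holomorphic start needs a common square-integrable place) — honoured by the auxiliary place `w₀` in
branch (A); §5 R7 (cross-ratio supply fails for projective images of order `≤ 10`) — honoured by the
explicit `by_cases` and `stub_noCrossPlaceSector`; §5 R1/D1/R2 — the sector stub's engines; §6 (expected
dimension `-1`, "accidents on demand") — the recorded risk of C⁺.  No `Negative/` lemma has landed for
this crux (nothing to import); negatives index: 1 entry (K3 Kuga–Satake anchor), unrelated; no stub is an
instance of a refuted statement.
-/

open Literature.NumberTheory.GaloisRepresentations Literature.NumberTheory.Automorphic
open IsDedekindDomain Polynomial

namespace Summit.Langlands.Langlands.Cruxes.StableYoshidaCongruence.SerreDualRibetSquare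

set_option linter.dupNamespace false
set_option linter.overlappingInstances false

/-! ## Stub 1 — the lever: Ribet's congruence-module square at a cross-ratio place (contains C⁺) -/

/-- **Stub 1 (cross-ratio Ribet package; HARDEST — the line's bet).**  Data: an odd prime `p`, the
residual pair `σ, σ' : Γ_ℚ → GL₂(k)` with the crux hypotheses (`AutGL2`, irreducible, `det σ = det σ' =
ε̄⁻¹`, non-conjugate, an `Sh`-witness — i.e. `(σ̄, σ̄')` is an ordinary `p`-distinguished Yoshida pair,
Disproof §4), and a CROSS-RATIO PLACE `v ∤ p`: `σ, σ'` unramified at `v` with Frobenius polynomials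
`(X-a)(X-b)`, `(X-c)(X-d)`, one cross pair of ratio `q_v` (`c = q_v a` or `a = q_v c`) and NO internal
ratio (`a ≠ q_v^{±1} b`, `c ≠ q_v^{±1} d`).  Conclusion: (A) an `Sh`-shaped `ρ₀` (symplectic-`ε⁻¹`,
Greenberg-ordinary `(0,0,1,1)`, `p`-distinguished, residually `(σ, σ')` through `red`) which is cuspidal
automorphic on `GL₄` (the route's inline `AutGL4` clause) AND unramified at every place
`w ∉ {v, w₀}`, `w ∤ p`, at which `σ` and `σ'` are unramified, for a single auxiliary place `w₀`; OR (B) a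
two-dimensional `ρ₁` whose inertia at `v` acts unipotently and non-trivially and whose Frobenius
polynomial at `v` is `p`-integral and reduces through `red` to `(X-a)(X-b)` or to `(X-c)(X-d)`.
INTENDED PROOF (sub-lemmas L1.1–L1.8 of the line card): (L1.1) `p`-ordinary weight-2 newforms `f, g`
with `ρ̄_f^∨ ≅ σ̄`, `ρ̄_g^∨ ≅ σ̄'` (KW = `AutGL2` + weight part of Serre + Hida; level `N(σ̄)`, `N(σ̄')`,
times `p` in the très ramifié case); (L1.2) simultaneous `GL₂` level raising of `f, g` at one `w₀ ∤ pN`,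
`w₀ ≠ v`, `Frob_{w₀} ∼ c`, `q_{w₀} ≡ -1 (p)` (Ribet / Diamond–Taylor) — hypothesis (yos); (L1.3) the
HOLOMORPHIC `p`-ordinary Yoshida lift `π = Y(f_{w₀}, g_{w₀})` of weight `(2,2)` (Roberts 2001; Arthur's
multiplicity formula: non-generic members at `∞` and at `w₀`), its eigensystem `𝔪` in the Hecke algebra
`𝕋 = 𝕋^{anemic} ⊗ Z(H(G_v//I_v))` acting on the cuspidal lattices `M = H⁰(𝔛_{K^v K_v}, ω²(-D))_𝔪`,
`L = H⁰(𝔛_{K^v I_v}, ω²(-D))_𝔪` (`K_v` hyperspecial, `I_v` Iwahori; integral models smooth at `v ≠ p`);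
(L1.4) the Iwahori-level Ribet square: `i : M^{⊕8} → L` (the `|W| = 8` Iwahori–Hecke degeneracies — the
full old space, NOT the two vertex maps of the card: see the file header), `t : L → M^{⊕8}` (traces along
the finite étale `𝔛_{I_v} → 𝔛_{K_v}`), `t ∘ i = H ∈ M₈(𝕋)`, `det H = unit · Δ_v` with
`Δ_v(Satake) = ∏_{8 root ratios}(1 - ratio · q_v⁻¹)` up to units (Iwahori–Hecke / Macdonald structure
constants; Schmidt 2005 tables for `GSp₄`), and `Δ_v ∈ 𝔪` through the cross factor; (L1.5) = C⁺, OPEN,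
THE BET: (a) Ihara/genericity — `i ⊗ κ` is injective at `𝔪`, equivalently the `𝔪`-part of mod-`p`
weight-`(2,2)` coherent `H⁰` has no non-generic (`IIIb`-type) irreducible `𝔽̄_p[GSp₄(ℚ_v)]`-submodule
(Clozel–Harris–Taylor-type statement; the amalgam/strong-approximation argument kills only abelian
submodules) together with `H⁰(𝔛, ω²(-D)) ⊗ κ = H⁰(𝔛_κ, ω²(-D))` at `𝔪`; (b) "Serre-dual Ihara" — `t` is
surjective at `𝔪` (≡ an injectivity for `H³(ω^{(1,1)})` mod `p` + vanishing of `H¹(ω²(-D))[p]` at `𝔪`);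
(L1.6) Ribet's conclusion: if every `𝕋`-eigensystem in `L` were `v`-old then `L ⊗ K = i(M^{⊕8}) ⊗ K`,
(a) makes `i` an isomorphism, (b) makes `t ∘ i` surjective, contradicting `det H ∈ 𝔪`; so some
`π' ≡ 𝔪` contributes to `L` with `π'_v` ramified Iwahori-spherical (for irreducible spherical `π_v`,
`π_v^{I} = H(G//I) · π_v^{K}`), holomorphic of weight `(2,2)`, `p`-ordinary; (L1.7) Galois: if `π'` is
of general type, `ρ₀ := ρ_{π',p}` (Taylor 1991 / Laumon / Weissauer), symplectic with multiplier `ε⁻¹`,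
Greenberg `(0,0,1,1)` and residually distinguished by ordinarity of `𝔪` (Hida theory for `GSp₄` in weight
`(2,2)`: Pilloni, Boxer–Calegari–Gee–Pilloni), residually `σ̄ ⊕ σ̄'`, unramified outside the level,
cuspidal on `GL₄` by Arthur / Gee–Taïbi ⇒ (A); (L1.8) if `π'` is of Yoshida type `Y(π₁', π₂')` then
`π₁', π₂'` are weight-2 cusp forms (archimedean packet) congruent to `σ̄, σ̄'`, and the ramified
Iwahori-spherical member `π'_v` of the local Yoshida packet forces `π'_{i,v} ≅ St ⊗ χ` unramified twist
for some `i` (packets `{IIa}`, `{Va, Va*}`, `{VIa, VIb}`; supercuspidal / ramified-principal-series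
constituents have no Iwahori vectors), whence `ρ₁ := ρ_{π_i'}` is unipotently ramified at `v` (Carayol)
with Frobenius polynomial ≡ `charpoly σ̄(Frob_v)` or `charpoly σ̄'(Frob_v)` (Bernstein-centre part of
`𝔪`) ⇒ (B).  Why it might fail: (L1.5) is expected to FAIL for most `(pair, v)` (expected dimension `-1`,
Disproof §6: C⁺ would mint "accidents on demand"); no coherent Ihara/genericity for `GSp₄` in weight 2 is
in print (Betti / definite analogues only: Sorensen 2006 needs `π_v ≡ 𝟙`; CHT's Ihara conjecture is open
in rank `≥ 2`); `p ∣ |GSp₄(𝔽_{q_v})|` (non-banal `v`, automatic at `p ∈ {3,5}`) complicates the mod-`p`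
Iwahori–Hecke theory; BCGP's "non-Eisenstein" vanishing steps are unavailable at a Yoshida `𝔪` (triage
F4).  Size: open (XL⁺).
[cite: Ribet, *Congruence relations between modular forms*, Proc. ICM 1983, Thm 1 (level raising) —
quoted as Thm 1 of Sorensen2006; DiamondTaylor1994; Sorensen2006 = arXiv:math/0504332, §1.1–1.2, §4.3
Lemma 5, Thm 2, Thm 4; Schmidt 2005 = doi:10.2969/jmsj/1158242058 (Iwahori-spherical representations of
GSp(4), Tables 1–3); Roberts–Schmidt 2007 = doi:10.1007/978-3-540-73324-9; Roberts2001;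
ClozelHarrisTaylor2008, "Ihara's lemma" Conjecture I; Taylor1991; GeeTaibi2019; Arthur2013; Pilloni2020;
BoxerEtAl2021, §4–§7; Carayol1986; KhareWintenberger2009] -/
theorem stub_crossRatioRibetPackage :
    ∀ (p : ℕ) [Fact p.Prime], p ≠ 2 → ∀ (k : Type) [Field k] [CharP k p] [IsAlgClosed k]
      [TopologicalSpace k] [DiscreteTopology k] (red : Valued.integer (PadicAlgCl p) →+* k)
      (σ σ' : FramedGaloisRep ℚ k 2)
      (hcpt : isCompact_glFiniteIntegralLevel 4 ℚ) (ι : PadicAlgCl p ≃+* ℂ)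
      (v : HeightOneSpectrum (NumberField.RingOfIntegers ℚ)) (a b c d : k),
      let εb : Field.absoluteGaloisGroup ℚ →* (ZMod p)ˣ :=
        (modularCyclotomicCharacter (AlgebraicClosure ℚ)
          (HasEnoughRootsOfUnity.natCard_rootsOfUnity (AlgebraicClosure ℚ) p)).comp
          (MulSemiringAction.toRingAut (Field.absoluteGaloisGroup ℚ) (AlgebraicClosure ℚ))
      let Sh := fun r : FramedGaloisRep ℚ (PadicAlgCl p) 4 =>
        (r.IsSymplecticWithMultiplierFun (fun g => algebraMap ℚ_[p] (PadicAlgCl p)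
          ((((GaloisRep.cyclotomicCharacter ℚ p g)⁻¹ : ℤ_[p]ˣ) : ℤ_[p]) : ℚ_[p])) ∧
        (∀ v : HeightOneSpectrum (NumberField.RingOfIntegers ℚ),
          ((p : ℕ) : NumberField.RingOfIntegers ℚ) ∈ v.asIdeal →
            r.IsGreenbergOrdinaryOfShapeAt v ![0, 0, 1, 1] ∧ r.IsResiduallyDistinguishedAt v ![0, 0, 1, 1]) ∧
        (∀ᶠ v : HeightOneSpectrum (NumberField.RingOfIntegers ℚ) in Filter.cofinite,
          r.IsUnramifiedAt v ∧ σ.IsUnramifiedAt v ∧ σ'.IsUnramifiedAt v ∧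
          ∃ (P : Polynomial (Valued.integer (PadicAlgCl p))) (P₁ P₂ : Polynomial k),
            r.HasFrobCharpolyAt v (P.map (Valued.integer (PadicAlgCl p)).subtype) ∧
            σ.HasFrobCharpolyAt v P₁ ∧ σ'.HasFrobCharpolyAt v P₂ ∧ P.map red = P₁ * P₂))
      let AutGL2 := fun s : FramedGaloisRep ℚ k 2 =>
        (∀ (hcpt₂ : isCompact_glFiniteIntegralLevel 2 ℚ) (ι : PadicAlgCl p ≃+* ℂ),
          ∃ π₂ : CuspidalAutomorphicRepData 2 ℚ hcpt₂, π₂.1.IsLAlgebraic ∧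
            ∀ᶠ v : HeightOneSpectrum (NumberField.RingOfIntegers ℚ) in Filter.cofinite,
              ∃ (a : Multiset ℂ) (P : Polynomial (Valued.integer (PadicAlgCl p))) (Pb : Polynomial k),
                π₂.1.HasSatakeParamAt v a ∧
                P.map (Valued.integer (PadicAlgCl p)).subtype = arithFrobPolyOfSatake ι v.residueCard 1 a ∧
                s.IsUnramifiedAt v ∧ s.HasFrobCharpolyAt v Pb ∧ P.map red = Pb)
      let AutGL4 := fun r : FramedGaloisRep ℚ (PadicAlgCl p) 4 =>
        (∃ π : CuspidalAutomorphicRepData 4 ℚ hcpt, π.1.IsLAlgebraic ∧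
          ∀ᶠ v : HeightOneSpectrum (NumberField.RingOfIntegers ℚ) in Filter.cofinite,
            ∃ a : Multiset ℂ, π.1.HasSatakeParamAt v a ∧ r.IsUnramifiedAt v ∧
              r.HasFrobCharpolyAt v (arithFrobPolyOfSatake ι v.residueCard 1 a))
      AutGL2 σ → AutGL2 σ' → σ.toGaloisRep.IsIrreducible → σ'.toGaloisRep.IsIrreducible →
      (∀ g, FramedRep.det σ g = (Units.map (ZMod.castHom (dvd_refl p) k).toMonoidHom (εb g))⁻¹ ∧
        FramedRep.det σ' g = FramedRep.det σ g) →
      (¬ ∃ g : GL (Fin 2) k, ∀ x, g * σ x * g⁻¹ = σ' x) →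
      (∃ ρ : FramedGaloisRep ℚ (PadicAlgCl p) 4, Sh ρ) →
      -- the cross-ratio place `v` (cross ratio `q_v` between `a` and `c`, no internal ratio)
      ((p : ℕ) : NumberField.RingOfIntegers ℚ) ∉ v.asIdeal →
      σ.IsUnramifiedAt v → σ'.IsUnramifiedAt v →
      σ.HasFrobCharpolyAt v ((X - C a) * (X - C b)) → σ'.HasFrobCharpolyAt v ((X - C c) * (X - C d)) →
      (c = (v.residueCard : k) * a ∨ a = (v.residueCard : k) * c) →
      (a ≠ (v.residueCard : k) * b ∧ b ≠ (v.residueCard : k) * a ∧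
        c ≠ (v.residueCard : k) * d ∧ d ≠ (v.residueCard : k) * c) →
      (∃ ρ₀ : FramedGaloisRep ℚ (PadicAlgCl p) 4, Sh ρ₀ ∧ AutGL4 ρ₀ ∧
          ∃ w₀ : HeightOneSpectrum (NumberField.RingOfIntegers ℚ),
            ∀ w : HeightOneSpectrum (NumberField.RingOfIntegers ℚ), w ≠ v → w ≠ w₀ →
              ((p : ℕ) : NumberField.RingOfIntegers ℚ) ∉ w.asIdeal →
              σ.IsUnramifiedAt w → σ'.IsUnramifiedAt w → ρ₀.IsUnramifiedAt w) ∨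
      (∃ ρ₁ : FramedGaloisRep ℚ (PadicAlgCl p) 2,
          (∀ 𝔓 ∈ v.primesAbove, ∀ τ ∈ 𝔓.inertia (Field.absoluteGaloisGroup ℚ),
            (((ρ₁ τ : GL (Fin 2) (PadicAlgCl p)) : Matrix (Fin 2) (Fin 2) (PadicAlgCl p)) - 1) ^ 2 = 0) ∧
          ¬ ρ₁.IsUnramifiedAt v ∧
          ∃ Q : Polynomial (Valued.integer (PadicAlgCl p)),
            ρ₁.HasFrobCharpolyAt v (Q.map (Valued.integer (PadicAlgCl p)).subtype) ∧
            (Q.map red = (X - C a) * (X - C b) ∨ Q.map red = (X - C c) * (X - C d))) := by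
  sorry

/-! ## Stub 2 — the level-raising congruence on the Galois side (Steinberg shape of unipotent ramification) -/

/-! ### Registered statement of Stub 2 (kept) and the lead's reshape

**Stub 2 (Steinberg congruence; provable now).**  Let `v` be a finite place of `ℚ` not above `p` and
`ρ₁ : Γ_ℚ → GL₂(ℚ̄_p)` continuous such that every inertia element at `v` acts UNIPOTENTLY and `ρ₁` is
ramified at `v`.  Then `ρ₁(I_𝔓) ⊂ 1 + ℚ̄_p N` for one nilpotent `N ≠ 0` (a group of unipotent `2 × 2`
matrices is conjugate into the upper unitriangular group), `τ ↦` the coefficient of `N` is a continuous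
additive character of `I_𝔓`, hence factors through the pro-`p` tame quotient `ℤ_p(1)` (wild inertia is
pro-`ℓ`, `ℓ = char v ≠ p`), on which an arithmetic Frobenius `φ` acts by `τ ↦ τ^{q_v}`; so
`ρ₁(φ) N ρ₁(φ)⁻¹ = q_v N`, `ρ₁(φ)` preserves `ker N` and has eigenvalues `{x, q_v x}`, and EVERY
arithmetic Frobenius at every `𝔓 ∣ v` has characteristic polynomial `(X - x)(X - q_v x)` (multiplying by
`1 + sN` does not change it; primes above `v` are conjugate).  If moreover the Frobenius polynomial is
`Q ∈ 𝒪_{ℚ̄_p}[X]` (then monic with integral roots `x, q_v x`) and `Q` reduces through `red` to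
`(X - a)(X - b)`, then `{a, b} = {x̄, q_v x̄}`: `a = q_v b` or `b = q_v a` — Ribet's necessary condition
for level raising, with no automorphic input.  Size: M on paper; L in Lean (structure of tame inertia of
`ℚ_ℓ` and the Frobenius action on it are not in Mathlib; `HasFrobCharpolyAt.unique_holds`,
`exists_smul_eq_of_mem_primesAbove_holds`, `exists_isArithFrobAt_of_mem_primesAbove_holds` are in tree).
[cite: Serre–Tate, *Good reduction of abelian varieties*, Ann. of Math. 88 (1968), Appendix (structure
of tame inertia, Grothendieck's monodromy); Carayol1986; DiamondTaylor1994, §1 (local shapes of lifts at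
`ℓ ≠ p` with unramified reduction)]

**RESHAPED by lead c2 (2026-08-16)** into two registered stubs with this statement PROVED from them below:
* `stub_steinbergMonodromy` (2a, CORE, ramification theory): the Grothendieck monodromy relation
  `ρ₁(φ) · N = q_v · N · ρ₁(φ)` for `N = ρ₁(τ) - 1`, `τ ∈ I_𝔓`, `φ` an arithmetic Frobenius at `𝔓 ∣ v`;
* `stub_steinbergEigenvalueRatio` (2b, TAIL, linear algebra): `F N = q N F`, `N ≠ 0`, `N² = 0`,
  `charpoly F = Q ↦ (X-a)(X-b)` under `red` ⇒ `a = q b ∨ b = q a`. -/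


/- **Stub 2a (`stub_steinbergMonodromy`, CORE; L in Lean, true — Grothendieck's monodromy relation in the
simplest case).**  Let `v ∤ p` be a finite place of `ℚ`, `ρ₁ : Γ_ℚ → GL₂(ℚ̄_p)` continuous with every inertia
element at `v` acting unipotently (`(ρ₁ τ - 1)² = 0` for `τ ∈ I_𝔓`, `𝔓 ∣ v`).  Then for every `𝔓 ∣ v`, every
`τ ∈ I_𝔓` and every ARITHMETIC Frobenius `φ` at `𝔓` (`IsArithFrobAt (𝓞 ℚ) φ 𝔓`: `φ x ≡ x^{q_v} mod 𝔓` on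
`ℤ̄`, so `φ ∈ D_𝔓`), with `N := ρ₁(τ) - 1`:  `ρ₁(φ) N = q_v • (N ρ₁(φ))`, i.e. `ρ₁(φ) N ρ₁(φ)⁻¹ = q_v N`.
PROOF SKETCH.  (1) Unipotent subgroup of `GL₂`: if `u = 1 + N`, `u' = 1 + N'` and `uu'` are unipotent
(`N² = N'² = (N+N'+NN')² = 0`) then `tr(NN') = 0`, which for rank-≤-1 nilpotents forces `N, N'` to have the
same image line (or one is `0`); hence `ρ₁(I_𝔓) ⊆ {1 + s N₀}` for one `N₀` with `N₀² = 0`, and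
`t : I_𝔓 → (ℚ̄_p, +)`, `ρ₁(τ) = 1 + t(τ) N₀`, is a continuous additive homomorphism.  (2) `t` kills the
wild ramification groups `Γ_ℚ^u(𝔓)`, `u > 0`: pass to an integral model / bounded image so that `t` takes
values in `p^{-m} 𝒪`, reduce modulo `p^{n}`: the target is discrete and `p`-power torsion, the image of
`Γ^u` is an `ℓ`-group (`Literature.NumberTheory.EllipticCurves.isPGroup_map_absUpperRamificationSubgroup`,
`ℓ = char v ≠ p`), hence trivial at every level, hence `t(Γ^u) = 0` (`ℓ`-adic separation; cf. the same
argument in `TateModuleUnipotentInertiaProofs.isTameAt_rationalTate_of_exists_fixed_of_det_eq_one`).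
(3) Frobenius law on tame inertia at finite level: for a finite Galois `E/ℚ` through which a finite-level
quotient of `ρ₁` factors, `𝔮 = 𝔓 ∩ E`, `θ₀ : G_0(𝔮) → κ(𝔮)ˣ`, `θ₀(s) = s(π)/π mod 𝔮`
(`exists_monoidHom_ramificationSubgroup_zero_units`, kernel `G_1`), one has `θ₀(φ s φ⁻¹) = φ(θ₀ s) = θ₀(s)^q`
(independence of `θ₀` from the uniformizer; `φ` acts as `x ↦ x^q` on `κ(𝔮)`), so `φ s φ⁻¹ ≡ s^q mod G_1`;
with `TameInertiaGlobalCyclic.exists_apply_inertia_eq_apply_wild_mul_zpow` / (2) this gives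
`t(φ τ φ⁻¹) = q t(τ)` for all `τ ∈ I_𝔓`, i.e. `ρ₁(φ)(t(τ)N₀)ρ₁(φ)⁻¹ = q t(τ) N₀`.  Everything cited is
PROVED in the tree (number-field ramification theory at `𝔓 ⊂ ℤ̄`: `RamificationFiltration*`,
`TameInertiaGlobalCyclic`, `TateModuleUnipotentInertiaProofs` §2; Frobenius elements
`exists_isArithFrobAt_of_mem_primesAbove_holds`, `card_quotient_under_eq_residueCard`).
[cite: SerreTate1968, Appendix; SerreLocalFields1979, Ch. IV §2 Prop. 7 Cor. 1 and Ex. / §3; DiamondTaylor1994, §1] -/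
/- LANDED p120944 (…SteinbergMonodromyTame.lean) + p121510 (…SteinbergMonodromy.lean), wave 2 worker a5ef…, 2026-08-16 — registered statement kept for the record:
```
    theorem stub_steinbergMonodromy :
    ∀ (p : ℕ) [Fact p.Prime] (v : HeightOneSpectrum (NumberField.RingOfIntegers ℚ))
      (ρ₁ : FramedGaloisRep ℚ (PadicAlgCl p) 2),
      ((p : ℕ) : NumberField.RingOfIntegers ℚ) ∉ v.asIdeal →
      (∀ 𝔓 ∈ v.primesAbove, ∀ τ ∈ 𝔓.inertia (Field.absoluteGaloisGroup ℚ),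
        (((ρ₁ τ : GL (Fin 2) (PadicAlgCl p)) : Matrix (Fin 2) (Fin 2) (PadicAlgCl p)) - 1) ^ 2 = 0) →
      ∀ 𝔓 ∈ v.primesAbove, ∀ τ ∈ 𝔓.inertia (Field.absoluteGaloisGroup ℚ),
        ∀ φ : Field.absoluteGaloisGroup ℚ, IsArithFrobAt (NumberField.RingOfIntegers ℚ) φ 𝔓 →
          ((ρ₁ φ : GL (Fin 2) (PadicAlgCl p)) : Matrix (Fin 2) (Fin 2) (PadicAlgCl p)) *
              (((ρ₁ τ : GL (Fin 2) (PadicAlgCl p)) : Matrix (Fin 2) (Fin 2) (PadicAlgCl p)) - 1) =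
            (v.residueCard : PadicAlgCl p) •
              ((((ρ₁ τ : GL (Fin 2) (PadicAlgCl p)) : Matrix (Fin 2) (Fin 2) (PadicAlgCl p)) - 1) *
                ((ρ₁ φ : GL (Fin 2) (PadicAlgCl p)) : Matrix (Fin 2) (Fin 2) (PadicAlgCl p))) := by
```
-/

/- **Stub 2b (`stub_steinbergEigenvalueRatio`, TAIL; M, Mathlib-level linear algebra + valuation-ring
integrality + reduction).**  Let `F, N ∈ M₂(ℚ̄_p)` with `N ≠ 0`, `N² = 0` and `F N = q • (N F)` (`q : ℕ`).  Then
`F` preserves the line `L = im N = ker N`, acts on it by `x` and on `ℚ̄_p²/L` by `y` with `x = q y`, so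
`charpoly F = (X - y)(X - q y)`.  If `charpoly F = Q.map (𝒪 ↪ ℚ̄_p)` for `Q ∈ 𝒪[X]` (`𝒪 = 𝒪_{ℚ̄_p}` the
valuation ring, integrally closed, so the roots `y, q y` of the monic `Q` lie in `𝒪`) and
`Q.map red = (X - a)(X - b)` in `k[X]`, then `{a, b} = {ȳ, q ȳ}` (unique factorisation of a monic quadratic
over a field), i.e. `a = q b ∨ b = q a` with `q` read in `k` through `Nat.cast` (`map_natCast`).
[folklore; cite: DiamondTaylor1994, §1 (shape of Steinberg lifts); SerreLocalFields1979, Ch. I §4 (valuation rings are integrally closed)] -/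
/- LANDED p120075 (…SteinbergEigenvalueRatio.lean), wave 2 worker aabd…, 2026-08-16 — registered statement kept for the record:
```
    theorem stub_steinbergEigenvalueRatio :
    ∀ (p : ℕ) [Fact p.Prime] (k : Type) [Field k]
      (red : Valued.integer (PadicAlgCl p) →+* k) (q : ℕ)
      (F N : Matrix (Fin 2) (Fin 2) (PadicAlgCl p))
      (Q : Polynomial (Valued.integer (PadicAlgCl p))) (a b : k),
      N ≠ 0 → N ^ 2 = 0 →
      F * N = (q : PadicAlgCl p) • (N * F) →
      F.charpoly = Q.map (Valued.integer (PadicAlgCl p)).subtype →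
      Q.map red = (X - C a) * (X - C b) →
      (a = (q : k) * b ∨ b = (q : k) * a) := by
```
-/

/-! **Stub 2 (`stub_steinbergCongruence`) — LANDED** as `Theorems/PhantomRMYoshidaStableYoshidaCongruenceSteinbergCongruence.lean`
(p121926, lead c2, assembled from the landed 2a + 2b; imported above, same namespace and registered signature).
The in-skeleton glue it replaces is kept for the record:
```
/- **Stub 2 (`stub_steinbergCongruence`) — now PROVED from Stubs 2a + 2b (lead c2 reshape).**  Let `v ∤ p`,
`ρ₁ : Γ_ℚ → GL₂(ℚ̄_p)` with unipotent inertia at `v` and RAMIFIED at `v`, Frobenius polynomial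
`Q ∈ 𝒪_{ℚ̄_p}[X]` at `v` reducing through `red` to `(X - a)(X - b)`.  Then `a = q_v b ∨ b = q_v a`.
Proof: ramification gives `𝔓 ∣ v` and `τ ∈ I_𝔓` with `ρ₁ τ ≠ 1`, i.e. `N := ρ₁ τ - 1 ≠ 0` with `N² = 0`;
an arithmetic Frobenius `φ` at `𝔓` exists (`exists_isArithFrobAt_of_mem_primesAbove_holds`); Stub 2a gives
`ρ₁(φ) N = q_v N ρ₁(φ)`, the hypothesis `HasFrobCharpolyAt` gives `charpoly ρ₁(φ) = Q`, and Stub 2b concludes. -/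
    theorem stub_steinbergCongruence :
    ∀ (p : ℕ) [Fact p.Prime] (k : Type) [Field k]
      (red : Valued.integer (PadicAlgCl p) →+* k)
      (v : HeightOneSpectrum (NumberField.RingOfIntegers ℚ))
      (ρ₁ : FramedGaloisRep ℚ (PadicAlgCl p) 2)
      (Q : Polynomial (Valued.integer (PadicAlgCl p))) (a b : k),
      ((p : ℕ) : NumberField.RingOfIntegers ℚ) ∉ v.asIdeal →
      (∀ 𝔓 ∈ v.primesAbove, ∀ τ ∈ 𝔓.inertia (Field.absoluteGaloisGroup ℚ),
        (((ρ₁ τ : GL (Fin 2) (PadicAlgCl p)) : Matrix (Fin 2) (Fin 2) (PadicAlgCl p)) - 1) ^ 2 = 0) →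
      ¬ ρ₁.IsUnramifiedAt v →
      ρ₁.HasFrobCharpolyAt v (Q.map (Valued.integer (PadicAlgCl p)).subtype) →
      Q.map red = (X - C a) * (X - C b) →
      (a = (v.residueCard : k) * b ∨ b = (v.residueCard : k) * a) := by
  intro p _ k _ red v ρ₁ Q a b hv huni hram hQ hred
  -- a ramified inertia element `τ` at some `𝔓 ∣ v`
  simp only [FramedGaloisRep.IsUnramifiedAt, not_forall, exists_prop] at hram
  obtain ⟨𝔓, h𝔓, τ, hτ, hne⟩ := hram
  -- an arithmetic Frobenius at `𝔓`
  obtain ⟨φ, hφ⟩ := HeightOneSpectrum.exists_isArithFrobAt_of_mem_primesAbove_holds (K := ℚ) (v := v) h𝔓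
  have hN0 : (((ρ₁ τ : GL (Fin 2) (PadicAlgCl p)) : Matrix (Fin 2) (Fin 2) (PadicAlgCl p)) - 1) ≠ 0 := by
    intro h
    exact hne (Units.ext (sub_eq_zero.mp h))
  exact stub_steinbergEigenvalueRatio p k red v.residueCard _ _ Q a b hN0 (huni 𝔓 h𝔓 τ hτ)
    (stub_steinbergMonodromy p v ρ₁ hv huni 𝔓 h𝔓 τ hτ φ hφ) (hQ 𝔓 h𝔓 φ hφ) hred
```
-/

/-! ## Stub 3 — irreducibility of a cuspidal `GL₄`-automorphic `Sh`-shaped representation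

**RESHAPED by lead c2 (2026-08-16)** into `stub_invariantSubspaceFinrankTwo` (3a, the Galois-side SHAPE of any
reducibility: every non-trivial proper invariant subspace is a plane — provable from the residual 2+2 multiplicity-free
type alone) + `stub_irreducibleOfCuspidalGL4_ofShape` (3b, the Fontaine–Mazur/Jacquet–Shalika core, taking 3a's
conclusion as an extra hypothesis; blocked on facts ABSENT from the tree, see the line's dead note), with the
registered `stub_irreducibleOfCuspidalGL4` PROVED from them below. -/

/- **Stub 3a (`stub_invariantSubspaceFinrankTwo`; L, PROVABLE NOW — lattices + Brauer–Nesbitt).**  Let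
`ρ₀ : Γ_ℚ → GL₄(ℚ̄_p)` be continuous whose Frobenius polynomials are a.e. `p`-integral and reduce through `red`
to `charpoly σ(Frob_v) · charpoly σ'(Frob_v)` for two IRREDUCIBLE `σ, σ' : Γ_ℚ → GL₂(k)`.  Then every
`Γ_ℚ`-invariant subspace `W ⊆ ℚ̄_p⁴` with `W ≠ 0, ℚ̄_p⁴` has dimension `2`.  WHY TRUE: take a `Γ`-stable
`𝒪_{ℚ̄_p}`-lattice `Λ` (`exists_integralModel_of_valuationSubring` / `exists_hasQlModel_holds`); `Λ ∩ W` is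
saturated, hence a direct summand (finitely generated torsion-free over the valuation ring `𝒪` ⇒ free), so the
reduction `Λ̄ = Λ ⊗ 𝔽̄_p ↪ Λ ⊗ k` contains the reduction of `Λ ∩ W` as a `Γ`-SUBrepresentation of dimension
`dim W`; by Chebotarev density (`chebotarev_artinRep_holds`, `absoluteGaloisGroup.frobenius_dense`) + continuity the
charpoly identity holds for every `g ∈ Γ_ℚ`, so Brauer–Nesbitt (`brauerNesbitt_holds`) gives
`(Λ̄ ⊗ k)^ss ≅ σ ⊕ σ'`, whose Jordan–Hölder constituents are two irreducible PLANES; a `Γ`-stable subspace of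
dimension `1` or `3` would contribute a constituent of dimension `1` (itself, or the quotient by it) — impossible.
Reusable beyond this line (crux 2's engines at the endoscopic point need exactly this shape statement).
Size: L.  Leans on: `FramedGaloisRep`, `HasFrobCharpolyAt`, `IsUnramifiedAt`, tree lattice/reduction API
(`exists_integralModel_of_valuationSubring`, `ResidualPair*`, `Semisimplification`, `CharpolySubquotient`,
`brauerNesbitt_holds`, `chebotarev_artinRep_holds`), Mathlib `Submodule`, `Module.finrank`.
[cite: SerreAbelianLadic1968, Ch. I §2.3 (Brauer–Nesbitt for ℓ-adic representations); CurtisReiner1962, (30.16);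
Ribet1976 (Invent. Math. 34), §2 (stable lattices and reduction)] -/
/- LANDED p123140 (…InvariantSubspaceFinrankTwo.lean; + BN part p122788, Frame part p122842), wave 3 worker a0f4…, 2026-08-16 — registered statement kept for the record:
```
    theorem stub_invariantSubspaceFinrankTwo :
    ∀ (p : ℕ) [Fact p.Prime] (k : Type) [Field k] [CharP k p] [IsAlgClosed k]
      [TopologicalSpace k] [DiscreteTopology k] (red : Valued.integer (PadicAlgCl p) →+* k)
      (σ σ' : FramedGaloisRep ℚ k 2) (ρ₀ : FramedGaloisRep ℚ (PadicAlgCl p) 4),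
      σ.toGaloisRep.IsIrreducible → σ'.toGaloisRep.IsIrreducible →
      (∀ᶠ v : HeightOneSpectrum (NumberField.RingOfIntegers ℚ) in Filter.cofinite,
          ρ₀.IsUnramifiedAt v ∧ σ.IsUnramifiedAt v ∧ σ'.IsUnramifiedAt v ∧
          ∃ (P : Polynomial (Valued.integer (PadicAlgCl p))) (P₁ P₂ : Polynomial k),
            ρ₀.HasFrobCharpolyAt v (P.map (Valued.integer (PadicAlgCl p)).subtype) ∧
            σ.HasFrobCharpolyAt v P₁ ∧ σ'.HasFrobCharpolyAt v P₂ ∧ P.map red = P₁ * P₂) →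
      ∀ W : Submodule (PadicAlgCl p) (Fin 4 → PadicAlgCl p),
        (∀ g : Field.absoluteGaloisGroup ℚ, ∀ x ∈ W,
          ((ρ₀ g : GL (Fin 4) (PadicAlgCl p)) : Matrix (Fin 4) (Fin 4) (PadicAlgCl p)).mulVec x ∈ W) →
        W ≠ ⊥ → W ≠ ⊤ → Module.finrank (PadicAlgCl p) W = 2 := by
```
-/

/-- **Stub 3b (`stub_irreducibleOfCuspidalGL4_ofShape`; BLOCKED on absent facts — the Fontaine–Mazur / Jacquet–Shalika core).**  Stub 3 with the conclusion of Stub 3a (every non-trivial proper invariant subspace is a plane) as an EXTRA hypothesis (last antecedent).  Original description:  Let `p` be odd,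
`σ, σ' : Γ_ℚ → GL₂(k)` irreducible with `det σ = det σ' = ε̄⁻¹`, and `ρ₀ : Γ_ℚ → GL₄(ℚ̄_p)` symplectic
with multiplier `ε⁻¹`, Greenberg-ordinary of shape `(0,0,1,1)` and residually distinguished at `p`, with
a.e. Frobenius polynomials `p`-integral reducing to `charpoly σ · charpoly σ'`, and AUTOMORPHIC: Satake
parameters of an L-algebraic cuspidal `π` on `GL₄(𝔸_ℚ)` match its Frobenius polynomials a.e.  Then `ρ₀`
is irreducible.  Why: a proper invariant subspace has dimension `2` (residual constituents `σ̄, σ̄'` are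
irreducible of dimension `2`, Brauer–Nesbitt), giving `ρ₁ ⊂ ρ₀ ↠ ρ₂`, both de Rham at `p` (ordinary of
this shape ⇒ semistable) with Hodge–Tate types `{0,1}|{0,1}` or `{0,0}|{1,1}` (or its dual); in the first
case `ρ₁, ρ₂` are modular of weight 2 (Kisin's Fontaine–Mazur theorem; `ρ̄_i ∈ {σ̄, σ̄'}` odd irreducible,
`p` odd), in the second `ρ₁` (resp. `ρ₂ ⊗ ε`) has finite image on `I_p` (Sen) and is odd, hence modular
of weight one (Pilloni–Stroh); either way `π` and an isobaric sum `π₁ ⊞ π₂` share Satake parameters at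
almost all places, contradicting Jacquet–Shalika.  Why it might fail / residue: `p = 3` or
`σ̄|_{Γ_{ℚ(ζ_p)}}` not absolutely irreducible (hypotheses of the Fontaine–Mazur theorems); these are the
documented small-image cases, where Tung / Pan-type extensions are needed.  Size: L (modulo the named
facts Kisin FM, Pilloni–Stroh, Jacquet–Shalika, which enter as cited Literature Props).
[cite: Kisin2009 (= doi:10.1090/S0894-0347-09-00628-6, the Fontaine–Mazur conjecture for GL₂), Thm;
Pilloni–Stroh, *Surconvergence, ramification et modularité*, Astérisque 382 (2016), Thm 1.1 (weight-one
Fontaine–Mazur); Jacquet–Shalika, *On Euler products and the classification of automorphic forms II*,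
Amer. J. Math. 103 (1981) = doi:10.2307/2374050, Thm 4.4; arXiv:2603.19768] -/
theorem stub_irreducibleOfCuspidalGL4_ofShape :
    ∀ (p : ℕ) [Fact p.Prime], p ≠ 2 → ∀ (k : Type) [Field k] [CharP k p] [IsAlgClosed k]
      [TopologicalSpace k] [DiscreteTopology k] (red : Valued.integer (PadicAlgCl p) →+* k)
      (σ σ' : FramedGaloisRep ℚ k 2)
      (hcpt : isCompact_glFiniteIntegralLevel 4 ℚ) (ι : PadicAlgCl p ≃+* ℂ)
      (ρ₀ : FramedGaloisRep ℚ (PadicAlgCl p) 4),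
      let εb : Field.absoluteGaloisGroup ℚ →* (ZMod p)ˣ :=
        (modularCyclotomicCharacter (AlgebraicClosure ℚ)
          (HasEnoughRootsOfUnity.natCard_rootsOfUnity (AlgebraicClosure ℚ) p)).comp
          (MulSemiringAction.toRingAut (Field.absoluteGaloisGroup ℚ) (AlgebraicClosure ℚ))
      let Sh := fun r : FramedGaloisRep ℚ (PadicAlgCl p) 4 =>
        (r.IsSymplecticWithMultiplierFun (fun g => algebraMap ℚ_[p] (PadicAlgCl p)
          ((((GaloisRep.cyclotomicCharacter ℚ p g)⁻¹ : ℤ_[p]ˣ) : ℤ_[p]) : ℚ_[p])) ∧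
        (∀ v : HeightOneSpectrum (NumberField.RingOfIntegers ℚ),
          ((p : ℕ) : NumberField.RingOfIntegers ℚ) ∈ v.asIdeal →
            r.IsGreenbergOrdinaryOfShapeAt v ![0, 0, 1, 1] ∧ r.IsResiduallyDistinguishedAt v ![0, 0, 1, 1]) ∧
        (∀ᶠ v : HeightOneSpectrum (NumberField.RingOfIntegers ℚ) in Filter.cofinite,
          r.IsUnramifiedAt v ∧ σ.IsUnramifiedAt v ∧ σ'.IsUnramifiedAt v ∧
          ∃ (P : Polynomial (Valued.integer (PadicAlgCl p))) (P₁ P₂ : Polynomial k),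
            r.HasFrobCharpolyAt v (P.map (Valued.integer (PadicAlgCl p)).subtype) ∧
            σ.HasFrobCharpolyAt v P₁ ∧ σ'.HasFrobCharpolyAt v P₂ ∧ P.map red = P₁ * P₂))
      let AutGL4 := fun r : FramedGaloisRep ℚ (PadicAlgCl p) 4 =>
        (∃ π : CuspidalAutomorphicRepData 4 ℚ hcpt, π.1.IsLAlgebraic ∧
          ∀ᶠ v : HeightOneSpectrum (NumberField.RingOfIntegers ℚ) in Filter.cofinite,
            ∃ a : Multiset ℂ, π.1.HasSatakeParamAt v a ∧ r.IsUnramifiedAt v ∧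
              r.HasFrobCharpolyAt v (arithFrobPolyOfSatake ι v.residueCard 1 a))
      σ.toGaloisRep.IsIrreducible → σ'.toGaloisRep.IsIrreducible →
      (∀ g, FramedRep.det σ g = (Units.map (ZMod.castHom (dvd_refl p) k).toMonoidHom (εb g))⁻¹ ∧
        FramedRep.det σ' g = FramedRep.det σ g) →
      Sh ρ₀ → AutGL4 ρ₀ →
      (∀ W : Submodule (PadicAlgCl p) (Fin 4 → PadicAlgCl p),
        (∀ g : Field.absoluteGaloisGroup ℚ, ∀ x ∈ W,
          ((ρ₀ g : GL (Fin 4) (PadicAlgCl p)) : Matrix (Fin 4) (Fin 4) (PadicAlgCl p)).mulVec x ∈ W) →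
        W ≠ ⊥ → W ≠ ⊤ → Module.finrank (PadicAlgCl p) W = 2) →
      ρ₀.toGaloisRep.IsIrreducible := by
  sorry

/-- **Stub 3 (`stub_irreducibleOfCuspidalGL4`, the registered shared statement) — PROVED from 3a + 3b.**  The
residual-pair clause of `Sh ρ₀` feeds Stub 3a; its conclusion is the extra hypothesis of Stub 3b. -/
theorem stub_irreducibleOfCuspidalGL4 :
    ∀ (p : ℕ) [Fact p.Prime], p ≠ 2 → ∀ (k : Type) [Field k] [CharP k p] [IsAlgClosed k]
      [TopologicalSpace k] [DiscreteTopology k] (red : Valued.integer (PadicAlgCl p) →+* k)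
      (σ σ' : FramedGaloisRep ℚ k 2)
      (hcpt : isCompact_glFiniteIntegralLevel 4 ℚ) (ι : PadicAlgCl p ≃+* ℂ)
      (ρ₀ : FramedGaloisRep ℚ (PadicAlgCl p) 4),
      let εb : Field.absoluteGaloisGroup ℚ →* (ZMod p)ˣ :=
        (modularCyclotomicCharacter (AlgebraicClosure ℚ)
          (HasEnoughRootsOfUnity.natCard_rootsOfUnity (AlgebraicClosure ℚ) p)).comp
          (MulSemiringAction.toRingAut (Field.absoluteGaloisGroup ℚ) (AlgebraicClosure ℚ))
      let Sh := fun r : FramedGaloisRep ℚ (PadicAlgCl p) 4 =>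
        (r.IsSymplecticWithMultiplierFun (fun g => algebraMap ℚ_[p] (PadicAlgCl p)
          ((((GaloisRep.cyclotomicCharacter ℚ p g)⁻¹ : ℤ_[p]ˣ) : ℤ_[p]) : ℚ_[p])) ∧
        (∀ v : HeightOneSpectrum (NumberField.RingOfIntegers ℚ),
          ((p : ℕ) : NumberField.RingOfIntegers ℚ) ∈ v.asIdeal →
            r.IsGreenbergOrdinaryOfShapeAt v ![0, 0, 1, 1] ∧ r.IsResiduallyDistinguishedAt v ![0, 0, 1, 1]) ∧
        (∀ᶠ v : HeightOneSpectrum (NumberField.RingOfIntegers ℚ) in Filter.cofinite,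
          r.IsUnramifiedAt v ∧ σ.IsUnramifiedAt v ∧ σ'.IsUnramifiedAt v ∧
          ∃ (P : Polynomial (Valued.integer (PadicAlgCl p))) (P₁ P₂ : Polynomial k),
            r.HasFrobCharpolyAt v (P.map (Valued.integer (PadicAlgCl p)).subtype) ∧
            σ.HasFrobCharpolyAt v P₁ ∧ σ'.HasFrobCharpolyAt v P₂ ∧ P.map red = P₁ * P₂))
      let AutGL4 := fun r : FramedGaloisRep ℚ (PadicAlgCl p) 4 =>
        (∃ π : CuspidalAutomorphicRepData 4 ℚ hcpt, π.1.IsLAlgebraic ∧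
          ∀ᶠ v : HeightOneSpectrum (NumberField.RingOfIntegers ℚ) in Filter.cofinite,
            ∃ a : Multiset ℂ, π.1.HasSatakeParamAt v a ∧ r.IsUnramifiedAt v ∧
              r.HasFrobCharpolyAt v (arithFrobPolyOfSatake ι v.residueCard 1 a))
      σ.toGaloisRep.IsIrreducible → σ'.toGaloisRep.IsIrreducible →
      (∀ g, FramedRep.det σ g = (Units.map (ZMod.castHom (dvd_refl p) k).toMonoidHom (εb g))⁻¹ ∧
        FramedRep.det σ' g = FramedRep.det σ g) →
      Sh ρ₀ → AutGL4 ρ₀ → ρ₀.toGaloisRep.IsIrreducible := by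
  intro p _ hp k _ _ _ _ _ red σ σ' hcpt ι ρ₀ εb Sh AutGL4 hirr hirr' hdet hSh hAut
  exact stub_irreducibleOfCuspidalGL4_ofShape p hp k red σ σ' hcpt ι ρ₀ hirr hirr' hdet hSh hAut
    (stub_invariantSubspaceFinrankTwo p k red σ σ' ρ₀ hirr hirr' hSh.2.2)


/-! ## Stub 4 — the no-cross-place sector (tiny images): functorial lifts

**RESHAPED by lead c2 (2026-08-16)** into `stub_crossPlaceOfCrossElement` (4a, Chebotarev SUPPLY: a cross-only
ELEMENT of `Γ_ℚ` — eigenvalue data read against the mod-`p` cyclotomic character — yields a cross-only PLACE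
`v ∤ p` with the glue's typed data; provable now from the tree's proved Chebotarev `chebotarev_artinRep_holds`) +
`stub_noCrossElementSector` (4b, the sector stub with the hypothesis weakened to "no cross-only element", a
finite-group-theoretic condition on `im(σ × σ' × ε̄)` — Disproof §5 R7; open), with the registered
`stub_noCrossPlaceSector` PROVED from them below. -/

/- **Stub 4a (`stub_crossPlaceOfCrossElement`; M/L, PROVABLE NOW — Chebotarev supply of cross-ratio places).**
If some `g ∈ Γ_ℚ` is CROSS-ONLY for the pair — `charpoly σ(g) = (X-a)(X-b)`, `charpoly σ'(g) = (X-c)(X-d)` with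
one cross pair in ratio `e = ε̄(g)` (`c = e a ∨ a = e c`) and no internal ratio (`a ≠ e^{±1} b`, `c ≠ e^{±1} d`,
spelled as four inequations) — then there is a finite place `v ∤ p` at which `σ, σ'` are unramified with
Frobenius polynomials `(X-a')(X-b')`, `(X-c')(X-d')` forming a cross-only datum for the ratio `q_v` (the glue's
typed hypothesis of the Ribet package).  WHY TRUE: `U = {h : σ h = σ g, σ' h = σ' g, ε̄ h = ε̄ g}` is open
(`σ, σ', ε̄` are continuous into discrete groups) and non-empty; arithmetic Frobenii at the unramified places
outside any finite set are dense (`absoluteGaloisGroup.frobenius_dense chebotarev_artinRep_holds`, as used in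
`Theorems/PhantomRMYoshidaStableYoshidaCongruenceCharpolyCongruence.lean`, p78811 — the model to follow), so some
`Frob_v ∈ U` with `v ∤ p`, `v` unramified in the finite extension cut out by `σ × σ'`; there
`ε̄(Frob_v) = q_v mod p` (`Frob_v ζ_p ≡ ζ_p^{q_v}` and `μ_p ↪ (ℤ̄/𝔓)ˣ` for `𝔓 ∤ p`), so `e ↦ (q_v : k)`
(`ZMod.castHom`, `map_natCast`), and the charpolys of ALL Frobenii at `v` agree (unramified: Frobenii at `v` are
conjugate modulo inertia; `HasFrobCharpolyAt` from one Frobenius, cf. `HasFrobCharpolyAt.unique_holds`,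
`hasFrobCharpolyAt_frobCharpoly`).  Size: M/L.  Leans on: `FramedGaloisRep`, `FramedRep.charpoly`,
`HasFrobCharpolyAt`, `IsUnramifiedAt`, `primesAbove`, `IsArithFrobAt`, `residueCard`, Mathlib
`modularCyclotomicCharacter`; tree `chebotarev_artinRep_holds`, `absoluteGaloisGroup.frobenius_dense`,
`exists_isArithFrobAt_of_mem_primesAbove_holds`, `ModNCyclotomicCharacter` API.
[cite: SerreAbelianLadic1968, Ch. I §2.2 (Chebotarev density, Cor. 2); Neukirch ANT VII §13] -/
/- LANDED p123368 (…CrossPlaceOfCrossElement.lean), wave 3 worker af5f…, 2026-08-16 — registered statement kept for the record: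
```
    theorem stub_crossPlaceOfCrossElement :
    ∀ (p : ℕ) [Fact p.Prime], p ≠ 2 → ∀ (k : Type) [Field k] [CharP k p] [IsAlgClosed k]
      [TopologicalSpace k] [DiscreteTopology k] (σ σ' : FramedGaloisRep ℚ k 2),
      let εb : Field.absoluteGaloisGroup ℚ →* (ZMod p)ˣ :=
        (modularCyclotomicCharacter (AlgebraicClosure ℚ)
          (HasEnoughRootsOfUnity.natCard_rootsOfUnity (AlgebraicClosure ℚ) p)).comp
          (MulSemiringAction.toRingAut (Field.absoluteGaloisGroup ℚ) (AlgebraicClosure ℚ))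
      (∃ (g : Field.absoluteGaloisGroup ℚ) (a b c d : k),
        FramedRep.charpoly σ g = (X - C a) * (X - C b) ∧
        FramedRep.charpoly σ' g = (X - C c) * (X - C d) ∧
        (c = ((Units.map (ZMod.castHom (dvd_refl p) k).toMonoidHom (εb g) : kˣ) : k) * a ∨
          a = ((Units.map (ZMod.castHom (dvd_refl p) k).toMonoidHom (εb g) : kˣ) : k) * c) ∧
        (a ≠ ((Units.map (ZMod.castHom (dvd_refl p) k).toMonoidHom (εb g) : kˣ) : k) * b ∧
          b ≠ ((Units.map (ZMod.castHom (dvd_refl p) k).toMonoidHom (εb g) : kˣ) : k) * a ∧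
          c ≠ ((Units.map (ZMod.castHom (dvd_refl p) k).toMonoidHom (εb g) : kˣ) : k) * d ∧
          d ≠ ((Units.map (ZMod.castHom (dvd_refl p) k).toMonoidHom (εb g) : kˣ) : k) * c)) →
      ∃ (v : HeightOneSpectrum (NumberField.RingOfIntegers ℚ)) (a b c d : k),
        ((p : ℕ) : NumberField.RingOfIntegers ℚ) ∉ v.asIdeal ∧
        σ.IsUnramifiedAt v ∧ σ'.IsUnramifiedAt v ∧
        σ.HasFrobCharpolyAt v ((X - C a) * (X - C b)) ∧ σ'.HasFrobCharpolyAt v ((X - C c) * (X - C d)) ∧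
        (c = (v.residueCard : k) * a ∨ a = (v.residueCard : k) * c) ∧
        (a ≠ (v.residueCard : k) * b ∧ b ≠ (v.residueCard : k) * a ∧
          c ≠ (v.residueCard : k) * d ∧ d ≠ (v.residueCard : k) * c) := by
```
-/

/-- **Stub 4b (`stub_noCrossElementSector`; OPEN sector — Stub 4 with its hypothesis sharpened to 'no cross-only ELEMENT', a finite-group condition, via Stub 4a).**  Original description:  Under the crux
hypotheses, if NO finite place `v ∤ p` at which `σ, σ'` are unramified carries a cross-only ratio (one
cross pair of Frobenius eigenvalues of ratio `q_v`, no internal pair of ratio `q_v^{±1}`) — by Chebotarev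
a condition on the finite group `im(σ̄ × σ̄')` saying it is tiny (Disproof §5 R7 / `CrossRatioSupply.py`:
in the phantom family exactly the projective images of order `≤ 10`) — then for every `ι` there is an
`Sh`-shaped `ρ₀` cuspidal automorphic on `GL₄` (irreducibility is Stub 3).  Engines: the explicit
functorial constructions of Disproof §5 — R1 (twist pairs `σ̄' ≅ σ̄ ⊗ η`, `p` inert in `E_η`:
`ρ₀ = ρ_f^∨ ⊗ Ind_E^ℚ φ^{1-c}`), D1 (dihedral pairs from one quadratic `K` with aligned ratio in
`im(1-c)`: `ρ₀ = ρ_g^∨ ⊗ Ind_K θ`, automorphic by Ramakrishnan / `AI ∘ BC`), R2 (`p = 3`,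
`𝔽₃`-symplectic model: Burkhardt–Weddle rational moduli + BCGP2025 Lemma 9.4.2 + Thm 8.3 — the sister
lines `level-three-weierstrass-switch ≈ burkhardt-weddle-two-three-anchor`), each landing through the
pattern of Disproof's `cruxAt_of_automorphic_lift`; plus the classification (Chebotarev + finite group
theory) of tiny-image eligible pairs.  HONEST RESIDUE (open): tiny-image pairs outside R1 ∪ D1 ∪ R2 (e.g.
the Disproof D-residue `χ̄' ∉ im(1-c)` with projective image `D₂–D₅`), where only a primitive `GSp₄`
object could serve (Disproof §6).  This stub is the crux's conclusion (minus irreducibility) restricted to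
an explicit sub-locus strictly smaller than the crux's; it is NOT served by this line's lever.  Size: open
(sector).
[cite: Ramakrishnan2000; ArthurClozelAMS120; BruinFilatov2022 = arXiv:2207.04393, Thm 1.2(4);
BoxerCalegariGeePilloni2025 = arXiv:2502.20645, Lemma 9.4.2, Thm 8.3; KhareWintenberger2009] -/
theorem stub_noCrossElementSector :
    ∀ (p : ℕ) [Fact p.Prime], p ≠ 2 → ∀ (k : Type) [Field k] [CharP k p] [IsAlgClosed k]
      [TopologicalSpace k] [DiscreteTopology k] (red : Valued.integer (PadicAlgCl p) →+* k)
      (σ σ' : FramedGaloisRep ℚ k 2),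
      let εb : Field.absoluteGaloisGroup ℚ →* (ZMod p)ˣ :=
        (modularCyclotomicCharacter (AlgebraicClosure ℚ)
          (HasEnoughRootsOfUnity.natCard_rootsOfUnity (AlgebraicClosure ℚ) p)).comp
          (MulSemiringAction.toRingAut (Field.absoluteGaloisGroup ℚ) (AlgebraicClosure ℚ))
      let Sh := fun r : FramedGaloisRep ℚ (PadicAlgCl p) 4 =>
        (r.IsSymplecticWithMultiplierFun (fun g => algebraMap ℚ_[p] (PadicAlgCl p)
          ((((GaloisRep.cyclotomicCharacter ℚ p g)⁻¹ : ℤ_[p]ˣ) : ℤ_[p]) : ℚ_[p])) ∧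
        (∀ v : HeightOneSpectrum (NumberField.RingOfIntegers ℚ),
          ((p : ℕ) : NumberField.RingOfIntegers ℚ) ∈ v.asIdeal →
            r.IsGreenbergOrdinaryOfShapeAt v ![0, 0, 1, 1] ∧ r.IsResiduallyDistinguishedAt v ![0, 0, 1, 1]) ∧
        (∀ᶠ v : HeightOneSpectrum (NumberField.RingOfIntegers ℚ) in Filter.cofinite,
          r.IsUnramifiedAt v ∧ σ.IsUnramifiedAt v ∧ σ'.IsUnramifiedAt v ∧
          ∃ (P : Polynomial (Valued.integer (PadicAlgCl p))) (P₁ P₂ : Polynomial k),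
            r.HasFrobCharpolyAt v (P.map (Valued.integer (PadicAlgCl p)).subtype) ∧
            σ.HasFrobCharpolyAt v P₁ ∧ σ'.HasFrobCharpolyAt v P₂ ∧ P.map red = P₁ * P₂))
      let AutGL2 := fun s : FramedGaloisRep ℚ k 2 =>
        (∀ (hcpt₂ : isCompact_glFiniteIntegralLevel 2 ℚ) (ι : PadicAlgCl p ≃+* ℂ),
          ∃ π₂ : CuspidalAutomorphicRepData 2 ℚ hcpt₂, π₂.1.IsLAlgebraic ∧
            ∀ᶠ v : HeightOneSpectrum (NumberField.RingOfIntegers ℚ) in Filter.cofinite,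
              ∃ (a : Multiset ℂ) (P : Polynomial (Valued.integer (PadicAlgCl p))) (Pb : Polynomial k),
                π₂.1.HasSatakeParamAt v a ∧
                P.map (Valued.integer (PadicAlgCl p)).subtype = arithFrobPolyOfSatake ι v.residueCard 1 a ∧
                s.IsUnramifiedAt v ∧ s.HasFrobCharpolyAt v Pb ∧ P.map red = Pb)
      AutGL2 σ → AutGL2 σ' → σ.toGaloisRep.IsIrreducible → σ'.toGaloisRep.IsIrreducible →
      (∀ g, FramedRep.det σ g = (Units.map (ZMod.castHom (dvd_refl p) k).toMonoidHom (εb g))⁻¹ ∧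
        FramedRep.det σ' g = FramedRep.det σ g) →
      (¬ ∃ g : GL (Fin 2) k, ∀ x, g * σ x * g⁻¹ = σ' x) →
      (∃ ρ : FramedGaloisRep ℚ (PadicAlgCl p) 4, Sh ρ) →
      -- no cross-only ELEMENT of `Γ_ℚ` (a condition on the finite group `im(σ × σ' × ε̄)`)
      (¬ (∃ (g : Field.absoluteGaloisGroup ℚ) (a b c d : k),
        FramedRep.charpoly σ g = (X - C a) * (X - C b) ∧
        FramedRep.charpoly σ' g = (X - C c) * (X - C d) ∧
        (c = ((Units.map (ZMod.castHom (dvd_refl p) k).toMonoidHom (εb g) : kˣ) : k) * a ∨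
          a = ((Units.map (ZMod.castHom (dvd_refl p) k).toMonoidHom (εb g) : kˣ) : k) * c) ∧
        (a ≠ ((Units.map (ZMod.castHom (dvd_refl p) k).toMonoidHom (εb g) : kˣ) : k) * b ∧
          b ≠ ((Units.map (ZMod.castHom (dvd_refl p) k).toMonoidHom (εb g) : kˣ) : k) * a ∧
          c ≠ ((Units.map (ZMod.castHom (dvd_refl p) k).toMonoidHom (εb g) : kˣ) : k) * d ∧
          d ≠ ((Units.map (ZMod.castHom (dvd_refl p) k).toMonoidHom (εb g) : kˣ) : k) * c))) →
      ∀ (hcpt : isCompact_glFiniteIntegralLevel 4 ℚ) (ι : PadicAlgCl p ≃+* ℂ),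
        ∃ ρ₀ : FramedGaloisRep ℚ (PadicAlgCl p) 4, Sh ρ₀ ∧
          (∃ π : CuspidalAutomorphicRepData 4 ℚ hcpt, π.1.IsLAlgebraic ∧
            ∀ᶠ v : HeightOneSpectrum (NumberField.RingOfIntegers ℚ) in Filter.cofinite,
              ∃ a : Multiset ℂ, π.1.HasSatakeParamAt v a ∧ ρ₀.IsUnramifiedAt v ∧
                ρ₀.HasFrobCharpolyAt v (arithFrobPolyOfSatake ι v.residueCard 1 a)) := by
  sorry

/-- **Stub 4 (`stub_noCrossPlaceSector`, the registered statement) — PROVED from 4a + 4b.**  No cross-only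
place ⇒ (contrapositive of the Chebotarev supply 4a) no cross-only element ⇒ the sector stub 4b. -/
theorem stub_noCrossPlaceSector :
    ∀ (p : ℕ) [Fact p.Prime], p ≠ 2 → ∀ (k : Type) [Field k] [CharP k p] [IsAlgClosed k]
      [TopologicalSpace k] [DiscreteTopology k] (red : Valued.integer (PadicAlgCl p) →+* k)
      (σ σ' : FramedGaloisRep ℚ k 2),
      let εb : Field.absoluteGaloisGroup ℚ →* (ZMod p)ˣ :=
        (modularCyclotomicCharacter (AlgebraicClosure ℚ)
          (HasEnoughRootsOfUnity.natCard_rootsOfUnity (AlgebraicClosure ℚ) p)).comp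
          (MulSemiringAction.toRingAut (Field.absoluteGaloisGroup ℚ) (AlgebraicClosure ℚ))
      let Sh := fun r : FramedGaloisRep ℚ (PadicAlgCl p) 4 =>
        (r.IsSymplecticWithMultiplierFun (fun g => algebraMap ℚ_[p] (PadicAlgCl p)
          ((((GaloisRep.cyclotomicCharacter ℚ p g)⁻¹ : ℤ_[p]ˣ) : ℤ_[p]) : ℚ_[p])) ∧
        (∀ v : HeightOneSpectrum (NumberField.RingOfIntegers ℚ),
          ((p : ℕ) : NumberField.RingOfIntegers ℚ) ∈ v.asIdeal →
            r.IsGreenbergOrdinaryOfShapeAt v ![0, 0, 1, 1] ∧ r.IsResiduallyDistinguishedAt v ![0, 0, 1, 1]) ∧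
        (∀ᶠ v : HeightOneSpectrum (NumberField.RingOfIntegers ℚ) in Filter.cofinite,
          r.IsUnramifiedAt v ∧ σ.IsUnramifiedAt v ∧ σ'.IsUnramifiedAt v ∧
          ∃ (P : Polynomial (Valued.integer (PadicAlgCl p))) (P₁ P₂ : Polynomial k),
            r.HasFrobCharpolyAt v (P.map (Valued.integer (PadicAlgCl p)).subtype) ∧
            σ.HasFrobCharpolyAt v P₁ ∧ σ'.HasFrobCharpolyAt v P₂ ∧ P.map red = P₁ * P₂))
      let AutGL2 := fun s : FramedGaloisRep ℚ k 2 =>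
        (∀ (hcpt₂ : isCompact_glFiniteIntegralLevel 2 ℚ) (ι : PadicAlgCl p ≃+* ℂ),
          ∃ π₂ : CuspidalAutomorphicRepData 2 ℚ hcpt₂, π₂.1.IsLAlgebraic ∧
            ∀ᶠ v : HeightOneSpectrum (NumberField.RingOfIntegers ℚ) in Filter.cofinite,
              ∃ (a : Multiset ℂ) (P : Polynomial (Valued.integer (PadicAlgCl p))) (Pb : Polynomial k),
                π₂.1.HasSatakeParamAt v a ∧
                P.map (Valued.integer (PadicAlgCl p)).subtype = arithFrobPolyOfSatake ι v.residueCard 1 a ∧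
                s.IsUnramifiedAt v ∧ s.HasFrobCharpolyAt v Pb ∧ P.map red = Pb)
      AutGL2 σ → AutGL2 σ' → σ.toGaloisRep.IsIrreducible → σ'.toGaloisRep.IsIrreducible →
      (∀ g, FramedRep.det σ g = (Units.map (ZMod.castHom (dvd_refl p) k).toMonoidHom (εb g))⁻¹ ∧
        FramedRep.det σ' g = FramedRep.det σ g) →
      (¬ ∃ g : GL (Fin 2) k, ∀ x, g * σ x * g⁻¹ = σ' x) →
      (∃ ρ : FramedGaloisRep ℚ (PadicAlgCl p) 4, Sh ρ) →
      -- no cross-only place anywhere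
      (¬ ∃ (v : HeightOneSpectrum (NumberField.RingOfIntegers ℚ)) (a b c d : k),
          ((p : ℕ) : NumberField.RingOfIntegers ℚ) ∉ v.asIdeal ∧
          σ.IsUnramifiedAt v ∧ σ'.IsUnramifiedAt v ∧
          σ.HasFrobCharpolyAt v ((X - C a) * (X - C b)) ∧ σ'.HasFrobCharpolyAt v ((X - C c) * (X - C d)) ∧
          (c = (v.residueCard : k) * a ∨ a = (v.residueCard : k) * c) ∧
          (a ≠ (v.residueCard : k) * b ∧ b ≠ (v.residueCard : k) * a ∧
            c ≠ (v.residueCard : k) * d ∧ d ≠ (v.residueCard : k) * c)) →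
      ∀ (hcpt : isCompact_glFiniteIntegralLevel 4 ℚ) (ι : PadicAlgCl p ≃+* ℂ),
        ∃ ρ₀ : FramedGaloisRep ℚ (PadicAlgCl p) 4, Sh ρ₀ ∧
          (∃ π : CuspidalAutomorphicRepData 4 ℚ hcpt, π.1.IsLAlgebraic ∧
            ∀ᶠ v : HeightOneSpectrum (NumberField.RingOfIntegers ℚ) in Filter.cofinite,
              ∃ a : Multiset ℂ, π.1.HasSatakeParamAt v a ∧ ρ₀.IsUnramifiedAt v ∧
                ρ₀.HasFrobCharpolyAt v (arithFrobPolyOfSatake ι v.residueCard 1 a)) := by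
  intro p _ hp k _ _ _ _ _ red σ σ' εb Sh AutGL2 hA hA' hirr hirr' hdet hnc hw hx hcpt ι
  refine stub_noCrossElementSector p hp k red σ σ' hA hA' hirr hirr' hdet hnc hw ?_ hcpt ι
  intro hel
  exact hx (stub_crossPlaceOfCrossElement p hp k σ σ' hel)


/-! ## Glue (sorry-free): the crux from the stubs -/

/-- **`StableYoshidaCongruence` from the line `serre-dual-ribet-square`.**  Case split on the existence of
a cross-only place `v` for the pair.  YES: the Ribet package (Stub 1) at `v` gives either a general-type
`ρ₀` (then Stub 3 supplies irreducibility) or an endoscopic `v`-new form, i.e. a weight-2 `ρ₁ ≡ σ̄` or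
`σ̄'` Steinberg at `v`, which Stub 2 turns into an internal ratio `q_v` — excluded by the choice of `v`.
NO: the sector stub (Stub 4) gives `ρ₀`, Stub 3 its irreducibility. -/
theorem StableYoshidaCongruence_of :
    Summit.Langlands.Langlands.Theses.PhantomRMYoshida.StableYoshidaCongruence := by
  refine fun p _ hp k _ _ _ _ _ red σ σ' hA hA' hirr hirr' hdet hnc hw hcpt ι => ?_
  by_cases hx : ∃ (v : HeightOneSpectrum (NumberField.RingOfIntegers ℚ)) (a b c d : k),
      ((p : ℕ) : NumberField.RingOfIntegers ℚ) ∉ v.asIdeal ∧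
      σ.IsUnramifiedAt v ∧ σ'.IsUnramifiedAt v ∧
      σ.HasFrobCharpolyAt v ((X - C a) * (X - C b)) ∧ σ'.HasFrobCharpolyAt v ((X - C c) * (X - C d)) ∧
      (c = (v.residueCard : k) * a ∨ a = (v.residueCard : k) * c) ∧
      (a ≠ (v.residueCard : k) * b ∧ b ≠ (v.residueCard : k) * a ∧
        c ≠ (v.residueCard : k) * d ∧ d ≠ (v.residueCard : k) * c)
  · -- the generic regime: Ribet's square at a cross-ratio place
    obtain ⟨v, a, b, c, d, hv, hur, hur', hP₁, hP₂, hcross, hab, hba, hcd, hdc⟩ := hx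
    rcases stub_crossRatioRibetPackage p hp k red σ σ' hcpt ι v a b c d hA hA' hirr hirr' hdet hnc hw
        hv hur hur' hP₁ hP₂ hcross ⟨hab, hba, hcd, hdc⟩ with
      ⟨ρ₀, hSh, hAut, -⟩ | ⟨ρ₁, huni, hram, Q, hQ, hred⟩
    · -- branch (A): a general-type `v`-new form; irreducibility from Stub 3
      exact ⟨ρ₀, stub_irreducibleOfCuspidalGL4 p hp k red σ σ' hcpt ι ρ₀ hirr hirr' hdet hSh hAut,
        hSh, hAut⟩
    · -- branch (B): an endoscopic `v`-new form would level-raise `σ̄` or `σ̄'` at `v` (Stub 2),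
      -- forcing an internal ratio — excluded at a cross-only place
      exfalso
      rcases hred with hred | hred
      · rcases stub_steinbergCongruence p k red v ρ₁ Q a b hv huni hram hQ hred with h | h
        · exact hab h
        · exact hba h
      · rcases stub_steinbergCongruence p k red v ρ₁ Q c d hv huni hram hQ hred with h | h
        · exact hcd h
        · exact hdc h
  · -- the tiny-image sector: no cross-only place at all
    obtain ⟨ρ₀, hSh, hAut⟩ :=
      stub_noCrossPlaceSector p hp k red σ σ' hA hA' hirr hirr' hdet hnc hw hx hcpt ι
    exact ⟨ρ₀, stub_irreducibleOfCuspidalGL4 p hp k red σ σ' hcpt ι ρ₀ hirr hirr' hdet hSh hAut,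
      hSh, hAut⟩

end Summit.Langlands.Langlands.Cruxes.StableYoshidaCongruence.SerreDualRibetSquare
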